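import Summits.ABC.ABC.Theses.IsogenyGlueCongruence
import Literature.NumberTheory.DiophantineGeometry.AbcSixteenReduction
import Literature.NumberTheory.EllipticCurves.DegreeConjectureAbc
import HarnessLib

/-!
# Route IsogenyGlueCongruence — item `AbcOfNormalisedAbc` / decl `Assembly2` (stmt-ABC-3920)

The elementary half of the route's assembly:

> sharp abc for *Serre-normalisable* triples (for every `ε > 0` there is `C` with
> `c ≤ C · rad(abc)^{1+ε}` for all abc triples `(a, b, c)` with `32 ∣ b`) ⟹ the abc conjecture
> (`∀ ε > 0 ∃ C > 0`, `c < C · rad(abc)^{1+ε}` for all abc triples — literally the body of `ABC`).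

Proof (folklore; the device of `Literature…DiophantineGeometry.abcLe_of_abcLe_sixteen_dvd`,
Bombieri–Gubler Ex. 12.5.10, applied to EVERY triple rather than only to those with `16 ∤ abc`).
Let `(a, b, c)` be an abc triple other than `(1, 1, 2)` and let `u < v` be its two odd members, `w`
the even one. The auxiliary triple `(u⁸, v⁸ − u⁸, v⁸)` is an abc triple
(`isABCTriple_pow_eight`) whose middle member is divisible by `32` — an odd eighth power is
`1 (mod 32)` (`pow_eight_mod_thirtytwo_of_odd`) — so the hypothesis applies to it; moreover
`w ∈ {v − u, v + u}` divides `v⁸ − u⁸ = (v − u)(v + u)(v² + u²)(v⁴ + u⁴)` with cofactor `≤ 8v⁷`,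
whence `rad(u⁸ (v⁸ − u⁸) v⁸) ≤ 8 v⁷ rad(abc)`. The hypothesis at exponent `1 + ε'` gives
`v⁸ ≤ C (8 v⁷ rad(abc))^{1+ε'}`, i.e. `v ≤ C' rad(abc)^{(1+ε')/(1−7ε')}` (`le_of_pow_eight_le`),
and `c ≤ 2v`; with `ε' = ε/(8 + 7ε)` one has `(1 + ε')/(1 − 7ε') = 1 + ε`. Finally the `≤`-form
implies the strict form with a positive constant (`abcLt_of_abcLe`, `C ↦ max C 0 + 1`).

## References

* E. Bombieri, W. Gubler, *Heights in Diophantine Geometry* (2006), Ex. 12.5.10 and pp. 431–432.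
  [BombieriGubler2006]
* J. Oesterlé, *Nouvelles approches du «théorème» de Fermat*, Sém. Bourbaki 694 (1988), §1, §3.
  [Oesterle1988]
-/

-- `Summit.<Summit>.<Problem>` is the mandated summit-side namespace (CONVENTIONS §2); for the
-- single-conjunct summit `ABC` the two coincide, so the duplicate `ABC.ABC` is deliberate.
set_option linter.dupNamespace false

noncomputable section

namespace Summit.ABC.ABC.Theorems

open UniqueFactorizationMonoid Literature.NumberTheory.DiophantineGeometry

/-! ### `32 ∣ v⁸ − u⁸` for odd `u ≤ v` -/

/-- An odd eighth power is `1 (mod 32)`. [folklore] -/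
theorem pow_eight_mod_thirtytwo_of_odd {u : ℕ} (hu : Odd u) : u ^ 8 % 32 = 1 := by
  have h : u % 32 < 32 := Nat.mod_lt _ (by norm_num)
  have hodd : (u % 32) % 2 = 1 := by
    rw [Nat.mod_mod_of_dvd _ (by norm_num : 2 ∣ 32)]; exact Nat.odd_iff.mp hu
  have key : ∀ r : ℕ, r < 32 → r % 2 = 1 → r ^ 8 % 32 = 1 := by decide
  rw [Nat.pow_mod]
  exact key _ h hodd

/-- For odd `u ≤ v`, `32 ∣ v⁸ − u⁸`. [folklore] -/
theorem thirtytwo_dvd_pow_eight_sub {u v : ℕ} (hu : Odd u) (hv : Odd v) (huv : u ≤ v) :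
    32 ∣ v ^ 8 - u ^ 8 :=
  (Nat.modEq_iff_dvd' (Nat.pow_le_pow_left huv 8)).mp
    ((pow_eight_mod_thirtytwo_of_odd hu).trans (pow_eight_mod_thirtytwo_of_odd hv).symm)

/-! ### The reduction -/

/-- **abc for triples with `32 ∣ b` implies abc (`≤`-forms).** If for every `ε > 0` there is `C`
such that `c ≤ C · rad(abc)^{1+ε}` for all abc triples `(a, b, c)` with `32 ∣ b`, then for every
`ε > 0` there is `C` such that `c ≤ C · rad(abc)^{1+ε}` for all abc triples. Every triple other
than `(1, 1, 2)` is sent to the auxiliary triple `(u⁸, v⁸ − u⁸, v⁸)` on its two odd members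
`u < v` (`32 ∣ v⁸ − u⁸`, `rad ≤ 8 v⁷ rad(abc)`, `c ≤ 2v`), to which the hypothesis is applied with
exponent `1 + ε'`, `ε' = ε / (8 + 7ε)` (module docstring). [folklore] -/
theorem abcLe_of_abcLe_thirtytwo_dvd
    (h : ∀ ε : ℝ, 0 < ε → ∃ C : ℝ, ∀ a b c : ℕ, IsABCTriple a b c → 32 ∣ b →
      (c : ℝ) ≤ C * ((rad a b c : ℕ) : ℝ) ^ (1 + ε)) :
    ∀ ε : ℝ, 0 < ε → ∃ C : ℝ, ∀ a b c : ℕ, IsABCTriple a b c →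
      (c : ℝ) ≤ C * ((rad a b c : ℕ) : ℝ) ^ (1 + ε) := by
  intro ε hε
  -- exponents
  set ε' : ℝ := ε / (8 + 7 * ε) with hε'def
  have hε' : 0 < ε' := by positivity
  have h7 : 7 * ε' < 1 := by
    rw [hε'def, ← lt_div_iff₀' (by norm_num : (0 : ℝ) < 7), div_lt_iff₀ (by positivity)]
    linarith
  have hexp : (1 + ε') / (1 - 7 * ε') = 1 + ε := by
    have h87 : (8 + 7 * ε) ≠ 0 := by positivity
    rw [div_eq_iff (by linarith), hε'def]
    field_simp
    ring
  -- constants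
  obtain ⟨C₂, hC₂⟩ := h ε' hε'
  set K : ℝ := max C₂ 0 with hKdef
  have hK : 0 ≤ K := le_max_right _ _
  set Kf : ℝ := 2 * (K * 8 ^ (1 + ε')) ^ (1 / (1 - 7 * ε')) with hKf
  set C : ℝ := max 2 Kf with hCdef
  refine ⟨C, fun a b c habc ↦ ?_⟩
  set R : ℝ := ((rad a b c : ℕ) : ℝ) with hRdef
  have hRpos : 0 < rad a b c := by rw [rad_def]; exact Nat.pos_of_ne_zero radical_ne_zero
  have hR : (1 : ℝ) ≤ R := by rw [hRdef]; exact_mod_cast hRpos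
  have hR0 : (0 : ℝ) ≤ R ^ (1 + ε) := by positivity
  have hRge : (1 : ℝ) ≤ R ^ (1 + ε) := Real.one_le_rpow hR (by linarith)
  -- the generic step, for a suitable choice of `(u, v, w)`
  have key : ∀ u v w Q : ℕ, u < v → Odd u → Odd v → Nat.Coprime u v →
      Nat.Coprime (u * v) w → v ^ 8 - u ^ 8 = w * Q → Q ≤ 8 * v ^ 7 →
      u * v * w = a * b * c → c ≤ 2 * v → (c : ℝ) ≤ C * R ^ (1 + ε) := by
    intro u v w Q huv hu hv hcop hcopw hQ hQle hperm hc2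
    obtain ⟨hT, -, hrad⟩ := isABCTriple_pow_eight huv hu hv hcop hcopw hQ hQle
    have h32 : 32 ∣ v ^ 8 - u ^ 8 := thirtytwo_dvd_pow_eight_sub hu hv huv.le
    have hv0 : (0 : ℝ) < v := by exact_mod_cast hv.pos
    have hb := hC₂ _ _ _ hT h32
    -- `rad' ≤ 8 v⁷ R`
    have hradR : radical (u * v * w) = rad a b c := by rw [rad_def, hperm]
    have hrad' : ((rad (u ^ 8) (v ^ 8 - u ^ 8) (v ^ 8) : ℕ) : ℝ) ≤ 8 * (v : ℝ) ^ 7 * R := by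
      rw [hRdef, ← hradR]; exact_mod_cast hrad
    have hb' : (v : ℝ) ^ 8 ≤ K * (8 * (v : ℝ) ^ 7 * R) ^ (1 + ε') := by
      have hcast : (((v ^ 8 : ℕ) : ℕ) : ℝ) = (v : ℝ) ^ 8 := by push_cast; ring
      rw [← hcast]
      calc (((v ^ 8 : ℕ) : ℕ) : ℝ)
          ≤ C₂ * ((rad (u ^ 8) (v ^ 8 - u ^ 8) (v ^ 8) : ℕ) : ℝ) ^ (1 + ε') := hb
        _ ≤ K * ((rad (u ^ 8) (v ^ 8 - u ^ 8) (v ^ 8) : ℕ) : ℝ) ^ (1 + ε') :=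
          mul_le_mul_of_nonneg_right (le_max_left _ _) (by positivity)
        _ ≤ K * (8 * (v : ℝ) ^ 7 * R) ^ (1 + ε') :=
          mul_le_mul_of_nonneg_left (Real.rpow_le_rpow (by positivity) hrad' (by linarith)) hK
    have hvle := le_of_pow_eight_le hv0 hK hR h7 hb'
    rw [hexp] at hvle
    calc (c : ℝ) ≤ 2 * (v : ℝ) := by exact_mod_cast hc2
      _ ≤ 2 * ((K * 8 ^ (1 + ε')) ^ (1 / (1 - 7 * ε')) * R ^ (1 + ε)) := by linarith
      _ = Kf * R ^ (1 + ε) := by rw [hKf]; ring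
      _ ≤ C * R ^ (1 + ε) := mul_le_mul_of_nonneg_right (le_max_right _ _) hR0
  -- parity analysis
  obtain ⟨ha, hb, habc, hcop⟩ := habc
  have hac : Nat.Coprime a c := by rw [← habc]; exact Nat.coprime_self_add_right.mpr hcop
  have hbc : Nat.Coprime b c := by rw [← habc]; exact Nat.coprime_add_self_right.mpr hcop.symm
  rcases Nat.even_or_odd a with ha2 | ha2 <;> rcases Nat.even_or_odd b with hb2 | hb2
  · -- both even: impossible
    exfalso
    have := Nat.dvd_gcd (even_iff_two_dvd.mp ha2) (even_iff_two_dvd.mp hb2)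
    rw [hcop.gcd_eq_one] at this
    omega
  · -- `a` even, `b` odd, `c` odd: `(u, v, w) = (b, c, a)`
    have hc2 : Odd c := by rw [← habc]; exact ha2.add_odd hb2
    have hbc' : b < c := by omega
    refine key b c a ((c + b) * (c ^ 2 + b ^ 2) * (c ^ 4 + b ^ 4)) hbc' hb2 hc2 hbc
      (Nat.Coprime.mul_left hcop.symm hac.symm) ?_ ?_ (by rw [← habc]; ring) (by omega)
    · have hle : b ^ 8 ≤ c ^ 8 := Nat.pow_le_pow_left hbc'.le 8
      have hca : c - b = a := by omega
      zify [hle, hbc'.le] at hca ⊢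
      rw [← hca]; ring
    · have h1 : c + b ≤ 2 * c := by omega
      have h2 : c ^ 2 + b ^ 2 ≤ 2 * c ^ 2 := by nlinarith
      have h3 : c ^ 4 + b ^ 4 ≤ 2 * c ^ 4 := by
        have := Nat.pow_le_pow_left hbc'.le 4; omega
      calc (c + b) * (c ^ 2 + b ^ 2) * (c ^ 4 + b ^ 4) ≤ (2 * c) * (2 * c ^ 2) * (2 * c ^ 4) :=
            Nat.mul_le_mul (Nat.mul_le_mul h1 h2) h3
        _ = 8 * c ^ 7 := by ring
  · -- `a` odd, `b` even, `c` odd: `(u, v, w) = (a, c, b)`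
    have hc2 : Odd c := by rw [← habc]; exact ha2.add_even hb2
    have hac' : a < c := by omega
    refine key a c b ((c + a) * (c ^ 2 + a ^ 2) * (c ^ 4 + a ^ 4)) hac' ha2 hc2 hac
      (Nat.Coprime.mul_left hcop hbc.symm) ?_ ?_ (by rw [← habc]; ring) (by omega)
    · have hle : a ^ 8 ≤ c ^ 8 := Nat.pow_le_pow_left hac'.le 8
      have hcb : c - a = b := by omega
      zify [hle, hac'.le] at hcb ⊢
      rw [← hcb]; ring
    · have h1 : c + a ≤ 2 * c := by omega
      have h2 : c ^ 2 + a ^ 2 ≤ 2 * c ^ 2 := by nlinarith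
      have h3 : c ^ 4 + a ^ 4 ≤ 2 * c ^ 4 := by
        have := Nat.pow_le_pow_left hac'.le 4; omega
      calc (c + a) * (c ^ 2 + a ^ 2) * (c ^ 4 + a ^ 4) ≤ (2 * c) * (2 * c ^ 2) * (2 * c ^ 4) :=
            Nat.mul_le_mul (Nat.mul_le_mul h1 h2) h3
        _ = 8 * c ^ 7 := by ring
  · -- both odd, `c` even
    rcases lt_trichotomy a b with hab | hab | hab
    · -- `(u, v, w) = (a, b, c)`
      refine key a b c ((b - a) * (b ^ 2 + a ^ 2) * (b ^ 4 + a ^ 4)) hab ha2 hb2 hcop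
        (Nat.Coprime.mul_left hac hbc) ?_ ?_ rfl (by omega)
      · have hle : a ^ 8 ≤ b ^ 8 := Nat.pow_le_pow_left hab.le 8
        zify [hle, hab.le]
        rw [← habc]; push_cast; ring
      · have h1 : b - a ≤ 2 * b := by omega
        have h2 : b ^ 2 + a ^ 2 ≤ 2 * b ^ 2 := by nlinarith
        have h3 : b ^ 4 + a ^ 4 ≤ 2 * b ^ 4 := by
          have := Nat.pow_le_pow_left hab.le 4; omega
        calc (b - a) * (b ^ 2 + a ^ 2) * (b ^ 4 + a ^ 4) ≤ (2 * b) * (2 * b ^ 2) * (2 * b ^ 4) :=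
              Nat.mul_le_mul (Nat.mul_le_mul h1 h2) h3
          _ = 8 * b ^ 7 := by ring
    · -- `a = b`: then `a = b = 1`, `c = 2`
      subst hab
      have ha1 : a = 1 := by simpa using hcop
      subst ha1
      have hc : c = 2 := by omega
      subst hc
      calc ((2 : ℕ) : ℝ) = 2 * 1 := by norm_num
        _ ≤ C * R ^ (1 + ε) :=
          mul_le_mul (le_max_left _ _) hRge zero_le_one (le_trans (by norm_num) (le_max_left _ _))
    · -- `(u, v, w) = (b, a, c)`
      refine key b a c ((a - b) * (a ^ 2 + b ^ 2) * (a ^ 4 + b ^ 4)) hab hb2 ha2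
        hcop.symm (Nat.Coprime.mul_left hbc hac) ?_ ?_ (by ring) (by omega)
      · have hle : b ^ 8 ≤ a ^ 8 := Nat.pow_le_pow_left hab.le 8
        zify [hle, hab.le]
        rw [← habc]; push_cast; ring
      · have h1 : a - b ≤ 2 * a := by omega
        have h2 : a ^ 2 + b ^ 2 ≤ 2 * a ^ 2 := by nlinarith
        have h3 : a ^ 4 + b ^ 4 ≤ 2 * a ^ 4 := by
          have := Nat.pow_le_pow_left hab.le 4; omega
        calc (a - b) * (a ^ 2 + b ^ 2) * (a ^ 4 + b ^ 4) ≤ (2 * a) * (2 * a ^ 2) * (2 * a ^ 4) :=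
              Nat.mul_le_mul (Nat.mul_le_mul h1 h2) h3
          _ = 8 * a ^ 7 := by ring

/-! ### The item -/

/-- **Item stmt-ABC-3920 (`AbcOfNormalisedAbc`, decl `Assembly2`), proved.** Sharp abc on
Serre-normalisable triples — for every `ε > 0` a `C` with `c ≤ C · rad(abc)^{1+ε}` for all abc
triples with `32 ∣ b` — implies the abc conjecture in its strict / positive-constant form
(`∀ ε > 0 ∃ C > 0 ∀` abc triples, `c < C · rad(abc)^{1+ε}`, the body of `ABC`): the reduction
`abcLe_of_abcLe_thirtytwo_dvd` through the auxiliary triple `(u⁸, v⁸ − u⁸, v⁸)`, followed by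
`abcLt_of_abcLe` (`C ↦ max C 0 + 1`).

The route decl `Summit.ABC.ABC.Theses.IsogenyGlueCongruence.Assembly2` was dropped from the route
file (2026-08-16, duplicate assembly; the item's proved record is unchanged), so the statement is
spelled out here verbatim as the item's ledger signature instead of naming that decl. [folklore] -/
theorem abcLt_of_abcLe_thirtytwo_dvd :
    (∀ ε : ℝ, 0 < ε → ∃ C : ℝ, ∀ a b c : ℕ, IsABCTriple a b c → 32 ∣ b →
      (c : ℝ) ≤ C * ((rad a b c : ℕ) : ℝ) ^ (1 + ε)) →
    ∀ ε : ℝ, 0 < ε → ∃ C : ℝ, 0 < C ∧ ∀ a b c : ℕ, IsABCTriple a b c →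
      (c : ℝ) < C * ((rad a b c : ℕ) : ℝ) ^ (1 + ε) := by
  intro h
  exact Literature.NumberTheory.EllipticCurves.abcLt_of_abcLe (abcLe_of_abcLe_thirtytwo_dvd h)

/-- Deprecated name of `abcLt_of_abcLe_thirtytwo_dvd` (it was stated against the route decl
`Summit.ABC.ABC.Theses.IsogenyGlueCongruence.Assembly2`, dropped from the route file 2026-08-16;
it remains the ledger's `closed_by` record of item stmt-ABC-3920). [folklore] -/
@[deprecated abcLt_of_abcLe_thirtytwo_dvd (since := "2026-08-16")]
alias isogenyGlueCongruence_assembly2_proof := abcLt_of_abcLe_thirtytwo_dvd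

end Summit.ABC.ABC.Theorems

end
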